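import Mathlib
import HarnessLib
import HarnessLib.Audit
import Summits.HodgeConjecture.HodgeConjecture.Theses.PadicSemiregularLift
import Summits.HodgeConjecture.HodgeConjecture.Theorems.HodgeAbelianVarieties.Negative.ExtremeCodimensions
import Literature.AlgebraicGeometry.HodgeTheory.AtiyahClassTraceReal
import Literature.AlgebraicGeometry.HodgeTheory.ChernCharacterBetti
import Literature.AlgebraicGeometry.HodgeTheory.WeilClasses
import Literature.AlgebraicGeometry.HodgeTheory.GlobalInvariantCycles
import Literature.AlgebraicGeometry.Motives.FamiliesVHS
import Literature.AlgebraicGeometry.Motives.AbelianVariety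

/-!
# Line `symmetry-ladder-isotypic-obstructions` — skeleton for crux `PadicSemiregularLift.HodgeAbelianVarieties`
(item stmt-HodgeConjecture-1333, route route-HodgeConjecture-PadicSemiregularLift, rank 4; crux-plan,
planner `planner-cruxplan-stmt-HodgeConjecture-1333-symmetry-ladder-isot-0`, 2026-08-16)

CRUX (FIXED, the route's typing): `HodgeAbelianVarieties := ∀ A : AbelianVariety ℂ, HodgeConjectureFor A.dim A.X`
— the Hodge conjecture for EVERY complex abelian variety (Hodge model + every rational `(p,p)`-class
in `algebraicClasses A.X p`).  By the landed Negative lemma `hodgeAbelianVarieties_iff_deepMiddle`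
(Theorems/HodgeAbelianVarieties/Negative/ExtremeCodimensions, p70486) it is equivalent, granted the
tree's named facts Hodge models / Lefschetz `(1,1)` / hard Lefschetz, to its DEEP MIDDLE
`2 ≤ p`, `2p ≤ dim A`.

IDEA (crux idea card `Cruxes/HodgeAbelianVarieties/Ideas/symmetry-ladder-isotypic-obstructions.md`,
triage r1: 1 fail / 2 pass, all three: "a META-TOOL — equivariant Buchweitz–Flenner on invariant
`Ext²` over fixed sub-families, semicontinuity rungs down a chain of subgroups of the anchor's
automorphism group, the last rung asking PLAIN semiregularity only at a very general point of a
positive-dimensional special sub-family; compose with a seed; the ladder lives on split anchors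
`E_Kⁿ × Ē_Kⁿ` (conjugate embedding), not on Jacobian anchors"). The ladder is an ENGINE PRODUCING
SEMIREGULAR SEEDS on Weil-type (more generally Mumford–Tate) families of abelian varieties; its
EXTERNAL contract is what this skeleton types, on REAL carriers only:

* a SEED at a complex point `z` of a smooth projective family `f : 𝒳 → S` of abelian varieties is a
  finite locally free `E` on the fibre `𝒳_z` which is `{0,1}`-SEMIREGULAR in the tree's REAL sense
  (`IsZeroOneSemiregular`: `(σ₀, σ₁) = (Tr, Tr(At ∘ ·)) : Ext²(E,E) → H²(𝒪) ⊕ H³(Ω¹)` injective —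
  Buchweitz–Flenner's `I`-semiregularity for `I = {1,2}`), whose `ch₁`, `ch₂` are restrictions of
  global classes that are of type `(1,1)`, `(2,2)` on EVERY fibre ("`ch` remains of Hodge type over
  `S`" in the degrees `I` controls) and whose `ch_p` is the restriction of a global class `G`
  (`SeedAt`); Chern characters are taken in a Chern character theory `T : ChernCharacterBetti`
  (functorial, additive, normalised, line-bundle exponential — exactly as in the line
  `TwinTwistorTransport/semiregular-twin-hodge-locus`);
* a class `w ∈ H²ᵖ(B(ℂ); ℂ)` on an abelian variety `B` is SEED-CERTIFIED (`Certified`) if `B` is a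
  fibre of such a family over a smooth irreducible quasi-projective base, `w` extends to a global
  class `W` that is rational `(p,p)` on every fibre, and `W` lies in the `ℂ`-span of
  ENDOMORPHISM-TRANSLATES `u^* G_j` (`u : 𝒳 → 𝒳` over `S`) of finitely many seed classes `G_j` and of
  `p`-th powers of global fibrewise-rational-`(1,1)` classes (`DivPow`; powers of one class span all
  divisor polynomials by polarisation).  Trivial, semi-homogeneous or line-bundle seeds only ever give
  divisor polynomials, so certification of a non-Lefschetz class REQUIRES a genuine semiregular seed
  with exceptional Chern character: the stub is binding, and killable by "forced kernel" theorems on a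
  named family (route kill criterion (b) style).

THE SIX REGISTERED STUBS (2–7; signatures over existing Literature/Mathlib/route declarations only — the
`local notation3`s below are abbreviations that EXPAND; no local definitions enter a signature):

* `stub_weilSectorSeeds` — THE LADDER'S HOME TURF (open; first target): for `K = ℚ(√-d)`, every
  rational `(n,n)` Weil class (`weilClassesOf A φ n d`, `A.dim = 2n`, `φ² = -d`, `n ≥ 2`) is
  seed-certified.  Intended proof = the ladder on the Weil-type Shimura family through `(A, φ, pol)`
  from the split anchor `E_Kⁿ × Ē_Kⁿ` with a product polarisation OF THE SAME DISCRIMINANT (every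
  component has one; there the Weil classes are divisor polynomials, Imai/Murasaki), `G₀ =
  U(h₊)(𝒪_K) × U(h₋)(𝒪_K)`, reflection-subgroup chain, exit seed at a very general point of the last
  fixed sub-family (e.g. the `E_K × B'` locus, signature `(n-1,n)`).  First instance beyond print:
  `n = 4`, `d ∈ {1, 3}` (then `n = 3` all discriminants of that `K` follow INSIDE the same stub by
  the same anchors one dimension down — no Schoen descent is needed or expressible here).
* `stub_seededGeneration` — given the Weil sector, EVERY deep-middle rational `(p,p)`-class on every
  abelian variety is a `ℂ`-combination of pull-backs `φ^* w` along homomorphisms `φ : A → B` of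
  seed-certified classes (André 1992 = Markman survey Thm 1.4 shape; open: general CM fields via split
  anchors `(B_Φ × B_Φ̄)ⁿ`, and Mumford–Tate families of non-CM classes from CM anchors — where the
  ladder has no large symmetry to offer and only plain seed existence is claimed).  HARDEST (scope).
* `stub_semiregularVHC` — KNOWN IN PRINT (Buchweitz–Flenner 2003 Thm 5.1 with `I = {1,2}` /
  Pridham 2024 / Bandiera–Lepri–Manetti 2023, + Artin algebraisation of the unobstructed formal
  deformation, + GAGA and "Chern classes of algebraic bundles are algebraic"): a seed at `z` makes `G`
  algebraic on the fibres over an analytic open `U ∋ z`.  Formal XL.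
* `stub_baireSpreading` — KNOWN (relative Hilbert schemes of the projective `f`, countable union of
  closed algebraic subsets, Baire, irreducibility of `S`; Markman survey §2 after Thm 2.1 citing
  Voisin; Perry arXiv:2604.00511 Thm 1.1 (ii)): algebraic over a non-empty open `U` ⇒ algebraic on
  every fibre.  Formal XL.
* `stub_algebraicClassesFunctorial` — KNOWN (Fulton Cor. 19.2 (b) / Kleiman moving by translations
  on abelian varieties; Lefschetz `(1,1)` as antecedent): endomorphism-translates and divisor powers
  of fibrewise-algebraic global classes are fibrewise algebraic; pull-back along homomorphisms of
  abelian varieties and along isomorphisms preserves `algebraicClasses`.  Formal L (the tree proves the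
  flat and the cup-with-divisor cases: `map_mem_algebraicClasses_of_flat`,
  `AbelianVariety.cupProduct_mem_algebraicClasses_one`).
* `stub_hodgeFacts` — the three named Literature facts the deep-middle reduction consumes
  (`nonempty_hodgeModel`, `lefschetzOneOne_rational`, `nonempty_hardLefschetzNFold`: GAGA + Hodge
  decomposition, Lefschetz `(1,1)`, hard Lefschetz; theorems in print, vendored as facts).

`HodgeAbelianVarieties_of` takes the six statements BY NAME (`h : Goal.stub_…`, each definitionally the
registered stub's statement) and concludes the crux BY NAME, sorry-free: deep-middle reduction (landed Negative lemma) → generation → for each generator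
`φ^* w`: certification data → each seed class `G_j` is algebraic near `z_j` (VHC stub) hence on every
fibre (spreading) → `W` algebraic on every fibre (functoriality (a)) → `w` on `B` (iso, (c)) →
`φ^* w` on `A` ((b)) → span.

DISPROOF USED (`Cruxes/HodgeAbelianVarieties/Disproof.lean`, cdisprove cycle 1, NO KILL): §3
`hodgeAbelianVarieties_iff_deepMiddle` is USED (imported from the landed Negative file) — seeds are
demanded only for `2 ≤ p ≤ dim/2`; §3 `weilItems_of` frontier (Weil sixfolds disc ≠ −1, `2n ≥ 8`) =
the first instance of `stub_weilSectorSeeds`; §4 `not_integralSaturationOnAbelianVarieties` honoured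
(everything is `ℚ`/`ℂ`-span: `algebraicClasses`, `Submodule.span ℂ`; a seed represents `m·w + Lefschetz`,
never an integral generator); `kaehler_analogue_fails`, `_false_without_proper`, `_false_without_groupLaw`
honoured (all families are smooth PROJECTIVE families of abelian varieties over quasi-projective bases:
`AVFamily`); `not_allHodgeTypeClassesAlgebraicOnAbelianVarieties` honoured (`IsRationalClass` carried in
`FlatHodge` and in every conclusion's hypotheses).  No landed Negative lemma
(`Negative/ExtremeCodimensions`) refutes an instance of any stub (they are positive/structural).
`ledger negatives --problem HodgeConjecture` (ELineConnectivity, DerivedTorelliFermat): no contact.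
-/

noncomputable section

namespace Summit.HodgeConjecture.HodgeConjecture.Cruxes.HodgeAbelianVarieties.SymmetryLadderIsotypicObstructions

open CategoryTheory AlgebraicGeometry MonoidalCategory
open Literature.AlgebraicGeometry Literature.AlgebraicGeometry.Motives
  Literature.AlgebraicGeometry.HodgeTheory Literature.AlgebraicTopology.SingularHomology
open Summit.HodgeConjecture.HodgeConjecture.Theses.PadicSemiregularLift

/-! ## Notation (abbreviations only; they expand in every signature) -/

/-- `Res[f, s, k, A]`: restriction `A|_{𝒳_s} ∈ Hᵏ(𝒳_s(ℂ); ℂ)` of a global class `A ∈ Hᵏ(𝒳(ℂ); ℂ)` to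
the fibre of `f : 𝒳 ⟶ S` over the complex point `s` (pull-back along `fiberι f s`). -/
local notation3 (prettyPrint := false) "Res[" f ", " s ", " k ", " A "]" =>
  complexBetti.map (Motives.fiberι f s) k A

/-- `AVFamily[𝒳, S, f, n]`: `f : 𝒳 ⟶ S` is a smooth projective family of relative dimension `n`
(`IsSmoothProjectiveFamily`), projective in Hartshorne's sense (a closed immersion into `ℙᴺ × S` over
`S`), over a SMOOTH, IRREDUCIBLE, QUASI-PROJECTIVE complex base, all of whose complex fibres are
(isomorphic to the underlying varieties of) abelian varieties of dimension `n`.  Intended instances: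
universal families over neat-level components of Shimura varieties of Weil / Mumford–Tate type. -/
local notation3 (prettyPrint := false) "AVFamily[" 𝒳 ", " S ", " f ", " n "]" =>
  (Motives.IsSmoothProjectiveFamily f n ∧
    (∃ (N : ℕ) (ι : 𝒳 ⟶ Motives.projectiveSpace N ℂ ⊗ S),
      IsClosedImmersion ι.left ∧ ι ≫ SemiCartesianMonoidalCategory.snd (Motives.projectiveSpace N ℂ) S = f) ∧
    IsQuasiProjectiveOver S ∧ Smooth (S).hom ∧ IrreducibleSpace (S).left ∧
    (∀ s : Motives.ComplexPoints S, ∃ B : AbelianVariety ℂ, B.dim = n ∧ Nonempty (B.X ≅ Motives.fiberOver f s)))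

/-- `FlatHodge[f, n, p, A]`: the global class `A ∈ H²ᵖ(𝒳(ℂ); ℂ)` restricts on EVERY fibre to a
rational class of Hodge type `(p,p)` (a flat family of Hodge classes: `S` lies in the Hodge locus of `A`). -/
local notation3 (prettyPrint := false) "FlatHodge[" f ", " n ", " p ", " A "]" =>
  (∀ s, IsRationalClass (Res[f, s, 2 * p, A]) ∧
    IsOfHodgeType n (Motives.fiberOver f s) (2 * p) p p (Res[f, s, 2 * p, A]))

/-- `DivPow[𝒳, f, n, p]`: the `p`-th cup powers `hᵖ` of global classes `h ∈ H²(𝒳(ℂ); ℂ)` that are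
rational of type `(1,1)` on every fibre (relative polarisations and the other flat divisor classes);
their `ℂ`-span is the space of degree-`p` polynomials in such classes (polarisation identity). -/
local notation3 (prettyPrint := false) "DivPow[" 𝒳 ", " f ", " n ", " p "]" =>
  {x : complexBetti 𝒳 (2 * p) | ∃ h : complexBetti 𝒳 (2 * 1),
    (∀ s, IsRationalClass (Res[f, s, 2 * 1, h]) ∧
      IsOfHodgeType n (Motives.fiberOver f s) (2 * 1) 1 1 (Res[f, s, 2 * 1, h])) ∧
    x = cupPowTwo h p}

/-- `SeedAt[T, 𝒳, S, f, n, p, G, z]`: a SEMIREGULAR SEED for the global class `G ∈ H²ᵖ(𝒳(ℂ); ℂ)` at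
the complex point `z`: a finite locally free `E` on the fibre `𝒳_z`, `{0,1}`-semiregular in the
tree's REAL sense (`(σ₀, σ₁)` injective on Mathlib's `Ext²(E,E)`), with `ch₁(E)`, `ch₂(E)` the
restrictions of global classes of type `(1,1)`, `(2,2)` on every fibre and `ch_p(E) = G|_{𝒳_z}`
(Chern characters in the theory `T`). -/
local notation3 (prettyPrint := false) "SeedAt[" T ", " 𝒳 ", " S ", " f ", " n ", " p ", " G ", " z "]" =>
  (∃ (E : (Motives.fiberOver f z).left.Modules) (hE : Motives.IsFiniteLocallyFree E),
    IsZeroOneSemiregular hE ∧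
    (∃ G₁ : complexBetti 𝒳 (2 * 1),
      (∀ s, IsOfHodgeType n (Motives.fiberOver f s) (2 * 1) 1 1 (Res[f, s, 2 * 1, G₁])) ∧
      (T : ChernCharacterBetti).ch (Motives.fiberOver f z) E 1 = Res[f, z, 2 * 1, G₁]) ∧
    (∃ G₂ : complexBetti 𝒳 (2 * 2),
      (∀ s, IsOfHodgeType n (Motives.fiberOver f s) (2 * 2) 2 2 (Res[f, s, 2 * 2, G₂])) ∧
      (T : ChernCharacterBetti).ch (Motives.fiberOver f z) E 2 = Res[f, z, 2 * 2, G₂]) ∧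
    (T : ChernCharacterBetti).ch (Motives.fiberOver f z) E p = Res[f, z, 2 * p, G])

/-- `Certified[T, B, p, w]`: the class `w ∈ H²ᵖ(B(ℂ); ℂ)` on the abelian variety `B` is
SEED-CERTIFIED: `B` is (isomorphic to) a fibre `𝒳_{s₁}` of an `AVFamily` of relative dimension
`B.dim`, `w` is the restriction of a global class `W` with `FlatHodge`, and `W` lies in the `ℂ`-span of
endomorphism-translates `u^* G_j` (`u : 𝒳 ⟶ 𝒳`, `u ≫ f = f`) of finitely many classes `G_j` carrying
seeds `SeedAt[T, …, G_j, z_j]`, together with `DivPow`. -/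
local notation3 (prettyPrint := false) "Certified[" T ", " B ", " p ", " w "]" =>
  (∃ (𝒳 S : Motives.SchemeOver ℂ) (f : 𝒳 ⟶ S) (s₁ : Motives.ComplexPoints S)
      (e : (B : AbelianVariety ℂ).X ≅ Motives.fiberOver f s₁) (W : complexBetti 𝒳 (2 * p)),
    AVFamily[𝒳, S, f, (B : AbelianVariety ℂ).dim] ∧ FlatHodge[f, (B : AbelianVariety ℂ).dim, p, W] ∧
    complexBetti.map e.hom (2 * p) (Res[f, s₁, 2 * p, W]) = w ∧
    ∃ (r : ℕ) (z : Fin r → Motives.ComplexPoints S) (G : Fin r → complexBetti 𝒳 (2 * p)),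
      (∀ j, SeedAt[T, 𝒳, S, f, (B : AbelianVariety ℂ).dim, p, G j, z j]) ∧
      W ∈ Submodule.span ℂ
        ({x : complexBetti 𝒳 (2 * p) | ∃ (j : Fin r) (u : 𝒳 ⟶ 𝒳), u ≫ f = f ∧
            x = complexBetti.map u (2 * p) (G j)} ∪ DivPow[𝒳, f, (B : AbelianVariety ℂ).dim, p]))

/-- `WeilSeeds[T]`: the imaginary-quadratic Weil sector is seed-certified in the theory `T` — for
`n ≥ 2`, `d > 0`, `A.dim = 2n`, `φ ≫ φ = -d`, every rational `(n,n)`-class of the Weil plane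
`weilClassesOf A φ n d` is `Certified`. -/
local notation3 (prettyPrint := false) "WeilSeeds[" T "]" =>
  (∀ (n d : ℕ), 2 ≤ n → 0 < d → ∀ (A : AbelianVariety ℂ) (φ : A ⟶ A), A.dim = 2 * n →
    φ ≫ φ = -(d • 𝟙 A) → ∀ c ∈ weilClassesOf A φ n d, IsRationalClass c →
      IsOfHodgeType (2 * n) A.X (2 * n) n n c → Certified[T, A, n, c])

/-- `Generated[T, A, p, c]`: `c` is a `ℂ`-combination of pull-backs `φ^* w` along homomorphisms
`φ : A ⟶ B` of abelian varieties of seed-certified classes `w` (André's shape). -/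
local notation3 (prettyPrint := false) "Generated[" T ", " A ", " p ", " c "]" =>
  (c ∈ Submodule.span ℂ {x : complexBetti (A : AbelianVariety ℂ).X (2 * p) |
    ∃ (B : AbelianVariety ℂ) (φ : A ⟶ B) (w : complexBetti B.X (2 * p)),
      Certified[T, B, p, w] ∧ x = complexBetti.map φ.hom.hom.hom (2 * p) w})

/-! ## The stub STATEMENTS as named propositions (`Goal.stub_…`)

The skeleton theorem `HodgeAbelianVarieties_of` takes its hypotheses BY NAME (`h : Goal.stub_…`), as the
skeleton audit requires; each `Goal.stub_X` is definitionally the statement of the registered stub `stub_X`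
below (same text), so `HodgeAbelianVarieties_of stub_weilSectorSeeds …` type-checks by unfolding. -/

namespace Goal

/-- Statement of `stub_weilSectorSeeds` (see its docstring). -/
def stub_weilSectorSeeds : Prop := ∃ T : ChernCharacterBetti, WeilSeeds[T]

/-- Statement of `stub_seededGeneration` (see its docstring). -/
def stub_seededGeneration : Prop := ∀ T : ChernCharacterBetti, WeilSeeds[T] →
    ∀ (A : AbelianVariety ℂ) (p : ℕ), 2 ≤ p → 2 * p ≤ A.dim →
      ∀ c : complexBetti A.X (2 * p), IsRationalClass c → IsOfHodgeType A.dim A.X (2 * p) p p c →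
        Generated[T, A, p, c]

/-- Statement of `stub_semiregularVHC` (see its docstring). -/
def stub_semiregularVHC : Prop := ∀ (T : ChernCharacterBetti) ⦃𝒳 S : Motives.SchemeOver ℂ⦄ (f : 𝒳 ⟶ S)
    (n p : ℕ) (G : complexBetti 𝒳 (2 * p)) (z : Motives.ComplexPoints S),
    AVFamily[𝒳, S, f, n] → SeedAt[T, 𝒳, S, f, n, p, G, z] →
      ∃ U : Set (Motives.ComplexPoints S), IsOpen U ∧ z ∈ U ∧
        ∀ s ∈ U, Res[f, s, 2 * p, G] ∈ algebraicClasses (Motives.fiberOver f s) p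

/-- Statement of `stub_baireSpreading` (see its docstring). -/
def stub_baireSpreading : Prop := ∀ ⦃𝒳 S : Motives.SchemeOver ℂ⦄ (f : 𝒳 ⟶ S) (n p : ℕ)
    (G : complexBetti 𝒳 (2 * p)), AVFamily[𝒳, S, f, n] →
    (∃ U : Set (Motives.ComplexPoints S), IsOpen U ∧ U.Nonempty ∧
      ∀ s ∈ U, Res[f, s, 2 * p, G] ∈ algebraicClasses (Motives.fiberOver f s) p) →
    ∀ s, Res[f, s, 2 * p, G] ∈ algebraicClasses (Motives.fiberOver f s) p

/-- Statement of `stub_algebraicClassesFunctorial` (see its docstring). -/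
def stub_algebraicClassesFunctorial : Prop := lefschetzOneOne_rational →
    (∀ ⦃𝒳 S : Motives.SchemeOver ℂ⦄ (f : 𝒳 ⟶ S) (n p : ℕ), AVFamily[𝒳, S, f, n] →
      ∀ (r : ℕ) (G : Fin r → complexBetti 𝒳 (2 * p)),
        (∀ j s, Res[f, s, 2 * p, G j] ∈ algebraicClasses (Motives.fiberOver f s) p) →
        ∀ W ∈ Submodule.span ℂ
            ({x : complexBetti 𝒳 (2 * p) | ∃ (j : Fin r) (u : 𝒳 ⟶ 𝒳), u ≫ f = f ∧
                x = complexBetti.map u (2 * p) (G j)} ∪ DivPow[𝒳, f, n, p]),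
          ∀ s, Res[f, s, 2 * p, W] ∈ algebraicClasses (Motives.fiberOver f s) p) ∧
    (∀ (A B : AbelianVariety ℂ) (φ : A ⟶ B) (p : ℕ) (w : complexBetti B.X (2 * p)),
      w ∈ algebraicClasses B.X p → complexBetti.map φ.hom.hom.hom (2 * p) w ∈ algebraicClasses A.X p) ∧
    (∀ (B : AbelianVariety ℂ) (Y : Motives.SchemeOver ℂ) (e : B.X ≅ Y) (p : ℕ) (y : complexBetti Y (2 * p)),
      y ∈ algebraicClasses Y p → complexBetti.map e.hom (2 * p) y ∈ algebraicClasses B.X p)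

/-- Statement of `stub_hodgeFacts` (see its docstring). -/
def stub_hodgeFacts : Prop := (∀ (n : ℕ) (X : Motives.SchemeOver ℂ), nonempty_hodgeModel n X) ∧
    lefschetzOneOne_rational ∧ (∀ (n : ℕ) (X : Motives.SchemeOver ℂ), nonempty_hardLefschetzNFold n X)

end Goal

/-! ## The six registered stubs (`sorry` occurs only here) -/

/-- **Stub 1 · `stub_weilSectorSeeds` — the ladder's home turf (open; first target).**  In SOME Chern
character theory `T` (intended: the topological Chern character), every rational `(n,n)` Weil class of
an imaginary-quadratic Weil-type abelian `2n`-fold `(A, φ)`, `φ² = -d`, `n ≥ 2`, is SEED-CERTIFIED: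
`A` is a fibre of a smooth projective family of abelian `2n`-folds over a smooth irreducible
quasi-projective base (intended: the universal family over a neat-level component of the Weil-type
Shimura variety `SU(n,n)`-quotient through `(A, φ, polarisation)`, of dimension `n²`), the Weil class
extends to a flat global class `W` (the local system `∧²ⁿ_K` has trivial `SU`-monodromy), and `W` is a
`ℂ`-combination of `𝒪_K`-translates `u^* G_j` of flat extensions `G_j` of `ch_n` of
`{0,1}`-SEMIREGULAR finite locally free seeds `E_j` on (very general) fibres `𝒳_{z_j}`, plus powers of
flat divisor classes.  INTENDED CONSTRUCTION (the symmetry ladder, card (i)–(iv), triage r1-2/r1-3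
sharpenings): anchor `s₀ = E_Kⁿ × Ē_Kⁿ` (`E_K = ℂ/𝒪_K`, conjugate `K`-action, product polarisation
`h₊ ⊕ h₋` with `det h₊ · det h₋` in the discriminant class of `(A, φ, pol)` — a split CM point isogenous to
such an anchor exists on EVERY connected Weil-type family (diagonalise the hermitian form `H` over `K` and
take the complex structure `±i` on the positive/negative lines), and there ALL Hodge classes are divisor
polynomials (`∧ᵖV_σⁿ ⊗ ∧ᵖV_σ̄ⁿ` is the image of `Symᵖ(V_σⁿ ⊗ V_σ̄ⁿ)`), so `G₀ = U(h₊)(𝒪_K) × U(h₋)(𝒪_K)`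
-equivariant seeds built from line bundles / sub-tori exist); rung (i): for a `G_i`-equivariant `F`,
all-order obstructions of the `G_i`-equivariant problem over the fixed sub-family `S^{G_i}` lie in
`Ext²(F,F)^{G_i}`, so `σ` injective on invariants transports `F` over `S^{G_i}` (equivariant BF/Pridham
on `[𝒳_{s}/G_i]`; Markman's `Ḡ`-descent is the `S^G = S` case, survey §11.3–11.5); rung (iii): at a
very general point of `S^{G_i}` the transported object is `G_{i+1}`-equivariant with `Ext²` no larger
(upper semicontinuity) — re-test on `(Ext²)^{G_{i+1}}`, with the triage proviso that a second anchor
used to certify generic injectivity must carry an object KNOWN to lie in the same relative moduli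
component; last rung `G_r = 1`: plain `{0,1}`-semiregularity of the exit object at a very general point
of `S^{G_{r-1}}` (e.g. the `E_K × B'` locus fixed by a reflection, `B'` of signature `(n-1,n)`) — that
exit object IS the typed seed.  KILL TEST (card (ii), needs no semiregularity): a candidate seed `F` at
`s₀` with `ev_F(KS v) ≠ 0` for some Weil direction `v ∈ T_{s₀}S` is obstructed at first order.
WHY IT MIGHT FAIL: no `{0,1}`-semiregular LOCALLY FREE exit object exists (Markman's objects are
reflexive/twisted; `Ω^{≥2}`-components of `σ` are not on real carriers yet — RESHAPE to perfect /
twisted carriers when they land); or every `G₀`-symmetric seed at the split anchor is first-order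
obstructed along the Weil directions (kill test); or `S^{G}` has no room (`Hom_G(V^*, V̄) = 0`, the
Jacobian-anchor failure of triage r1-2 — avoided here by the conjugate embedding, `dim S^G = dim End_G V ≥ 1`).
First instance beyond print: `n = 4`, `d ∈ {1,3}`; `n = 3`, all discriminants, is the printed frontier
(arXiv:2603.20268 p. 3; Disproof §3 `weilItems_of`). [informal size XL; open] -/
theorem stub_weilSectorSeeds : ∃ T : ChernCharacterBetti, WeilSeeds[T] := by
  sorry

/-- **Stub 2 · `stub_seededGeneration` — from the Weil sector to every abelian variety (open; widest
scope, ranked hardest).**  For every Chern character theory `T` in which the imaginary-quadratic Weil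
sector is seed-certified, EVERY rational `(p,p)`-class in the deep middle (`2 ≤ p`, `2p ≤ dim A`) of
EVERY complex abelian variety `A` is a `ℂ`-combination of pull-backs `φ^* w` along homomorphisms
`φ : A ⟶ B` of seed-certified classes `w` on abelian varieties `B`.  Printed skeleton of the intended
proof: (1) `A` of CM type: André 1992 (= Markman survey arXiv:2509.23403 Thm 1.4, READ): every Hodge
class is `Σ fᵢ^*(tᵢ)`, `fᵢ : A → Aᵢ` homomorphisms, `tᵢ` Weil classes on abelian varieties `Aᵢ` of
SPLIT Weil type relative to CM fields `Kᵢ`; for `Kᵢ` imaginary quadratic this is the antecedent; for a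
general CM field `K` the same ladder is claimed on the `K`-Weil-type family (`∏ U(n,n)` quotient) from
the split anchor `(B_Φ × B_Φ̄)ⁿ = B_Φ^{2n}` (`B_Φ` the simple CM abelian variety of type `(K, Φ)`,
conjugate action on the second factor; its `K`-Weil classes lie in the span of exterior products of
the `(1,1)` Weil classes of the factors `B_Φ × B_Φ̄`, hence are divisor polynomials), symmetry
`U(h₊)(𝒪_K) × U(h₋)(𝒪_K) ⊇ μ(K) ≀ Sₙ`.  (2) `A` not of CM type: Deligne 1982 (Hodge cycles on abelian
varieties, §6 with Principle B's setting): `(A, c)` lies on the Mumford–Tate family `S(M)` (neat level: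
smooth, quasi-projective, irreducible; universal abelian scheme projective over it) on which `c`
extends to a flat global class, and `S(M)` contains CM points; take `B = A`, `φ = 𝟙`, and CLAIM a seed
for the flat extension somewhere on `S(M)` — here the anchor's automorphism group is only `μ(CM field)`
and the ladder offers no rungs: PLAIN SEED EXISTENCE at a very general point is what is claimed (honest
residual of the line; it is the object-level form of Grothendieck's variational Hodge conjecture for
abelian schemes, which is known to imply HC for abelian varieties: Bloch–Esnault–Kerz arXiv:1310.1773
p. 3, READ, "it is known [Ab], [An] that Conj. (VHC) for abelian schemes ⟹ Hodge conj. for abelian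
varieties", Abdulali 1994, André 1996).  (3) Lefschetz classes: `B = A`, `φ = 𝟙`, the one-point family,
`r = 0` seeds, `W ∈ span DivPow`.  WHY IT MIGHT FAIL: a Mumford–Tate family none of whose members
carries a `{0,1}`-semiregular locally free bundle with the exceptional `ch_p` (forced kernel), or a CM
field `K` whose split anchors are all first-order obstructed. [informal size XXL; open] -/
theorem stub_seededGeneration : ∀ T : ChernCharacterBetti, WeilSeeds[T] →
    ∀ (A : AbelianVariety ℂ) (p : ℕ), 2 ≤ p → 2 * p ≤ A.dim →
      ∀ c : complexBetti A.X (2 * p), IsRationalClass c → IsOfHodgeType A.dim A.X (2 * p) p p c →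
        Generated[T, A, p, c] := by
  sorry

/-- **Stub 3 · `stub_semiregularVHC` — the last rung: Buchweitz–Flenner / Pridham for a
`{0,1}`-semiregular vector bundle (KNOWN IN PRINT; formal XL).**  For every Chern character theory `T`,
every `AVFamily` `f : 𝒳 ⟶ S` and every seed `SeedAt[T, …, G, z]`: the class `G` is algebraic on the
fibres over an (analytic) open neighbourhood `U` of `z` in `S(ℂ)`.  Printed proof: `E` is
`I`-semiregular for `I = {1,2}` (`σ_{p-1}` controls `ch_p`; BF 2003 §5) and `ch₁(E) = G₁|_z`,
`ch₂(E) = G₂|_z` remain of Hodge type over the whole germ `(S, z)` (their flat transports ARE `G₁|_s`,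
`G₂|_s`: global classes restrict to flat sections), so every obstruction `ob ∈ Ext²(E,E)` has
`σ₀(ob) = σ₁(ob) = 0`, hence vanishes (BuchweitzFlenner2003 Thm 5.1; Pridham2024 = arXiv:1208.3111 /
BandieraLepriManetti2023 for the all-order statement; Markman survey Thm 2.1): `E` deforms formally
over `Ô_{S,z}`; the relative moduli of sheaves being locally of finite type, Artin approximation gives
an étale neighbourhood `(V, z') → (S, z)` and an ALGEBRAIC vector bundle `ℰ` on `𝒳 ×_S V` extending
`E`; `T.ch_p(ℰ)` is a global class on the family over `V` agreeing with (the pull-back of) `G` at `z'`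
(functoriality of `T` along the fibre inclusions), hence on every fibre over the connected component of
`z'` (flatness of global classes); on each fibre `T.ch_p(ℰ_v) ∈ algebraicClasses` (Chern classes of
algebraic vector bundles on a smooth projective variety are algebraic: Fulton Prop. 19.1.2, the theory's
`chVirtual_mem_algebraicClasses`); and the image of `V(ℂ) → S(ℂ)` contains an open `U ∋ z` (étale ⇒
open).  The statement is insensitive to the Adams-type ambiguity `T ↦ T ∘ ψᵏ` of `ChernCharacterBetti`.
[cite: BuchweitzFlenner2003, Thm 5.1] [informal size XL; known] -/
theorem stub_semiregularVHC : ∀ (T : ChernCharacterBetti) ⦃𝒳 S : Motives.SchemeOver ℂ⦄ (f : 𝒳 ⟶ S)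
    (n p : ℕ) (G : complexBetti 𝒳 (2 * p)) (z : Motives.ComplexPoints S),
    AVFamily[𝒳, S, f, n] → SeedAt[T, 𝒳, S, f, n, p, G, z] →
      ∃ U : Set (Motives.ComplexPoints S), IsOpen U ∧ z ∈ U ∧
        ∀ s ∈ U, Res[f, s, 2 * p, G] ∈ algebraicClasses (Motives.fiberOver f s) p := by
  sorry

/-- **Stub 4 · `stub_baireSpreading` — open ⇒ everywhere (KNOWN; formal XL).**  On an `AVFamily`
(projective `f`, smooth irreducible quasi-projective `S`), a global class `G ∈ H²ᵖ(𝒳(ℂ); ℂ)` which is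
algebraic on the fibres over a non-empty open subset of `S(ℂ)` is algebraic on EVERY fibre.  Printed
proof: write `G = Σ λ_k G_k` with `G_k` rational global classes and `λ_k` `ℚ`-linearly independent;
`G|_s ∈ Nᵖ(𝒳_s)_ℚ ⊗ ℂ` iff every `G_k|_s ∈ Nᵖ(𝒳_s)_ℚ`; for a rational flat class the algebraicity
locus is a COUNTABLE union of closed algebraic subsets of `S` (components of the relative Hilbert scheme
of the projective `f`, proper over `S`, with `ℚ`-coefficient vectors: the locus where a given
combination of their cycle classes equals `G_k|_s` is closed), it contains the open `U`, so by Baire one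
member has non-empty interior and, `S` being irreducible, is all of `S` ("the locus where it is
algebraic is a countable union of Zariski closed analytic subsets [voisin], and it contains the
non-empty open subset `U`", Markman survey §2; Perry arXiv:2604.00511 Thm 1.1 (ii); the tree's
`TropicalCuspLift.BaireSpreading` is the topological skeleton). [cite: Markman2025SurveySecant, §2]
[informal size XL; known] -/
theorem stub_baireSpreading : ∀ ⦃𝒳 S : Motives.SchemeOver ℂ⦄ (f : 𝒳 ⟶ S) (n p : ℕ)
    (G : complexBetti 𝒳 (2 * p)), AVFamily[𝒳, S, f, n] →
    (∃ U : Set (Motives.ComplexPoints S), IsOpen U ∧ U.Nonempty ∧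
      ∀ s ∈ U, Res[f, s, 2 * p, G] ∈ algebraicClasses (Motives.fiberOver f s) p) →
    ∀ s, Res[f, s, 2 * p, G] ∈ algebraicClasses (Motives.fiberOver f s) p := by
  sorry

/-- **Stub 5 · `stub_algebraicClassesFunctorial` — functoriality package for `Nᵖ H²ᵖ` on families of
abelian varieties (KNOWN; formal L), granted Lefschetz `(1,1)` (named fact, antecedent).**
(a) On an `AVFamily`, if the global classes `G_j` are algebraic on every fibre then so is every `W` in
the `ℂ`-span of their endomorphism-translates `u^* G_j` (`u ≫ f = f`: `(u^* G_j)|_s = u_s^*(G_j|_s)` for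
the induced endomorphism `u_s` of the smooth projective fibre — Fulton Cor. 19.2 (b), on an abelian
variety `u_s` = translation ∘ homomorphism and Kleiman moving by translations suffices) and of `DivPow`
(`(hᵖ)|_s = (h|_s)ᵖ`, `h|_s` rational `(1,1)` hence algebraic by Lefschetz `(1,1)`, cup products of
divisor classes algebraic — the tree's `AbelianVariety.cupProduct_mem_algebraicClasses_one`, iterated).
(b) Pull-back along a homomorphism `φ : A ⟶ B` of abelian varieties maps `algebraicClasses B.X p` into
`algebraicClasses A.X p` (Fulton Cor. 19.2 (b); `φ` = flat surjection onto an abelian subvariety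
followed by a closed immersion, moved by translations).  (c) Pull-back along an isomorphism
`B.X ≅ Y` of `ℂ`-schemes preserves algebraic classes (the flat case, in the tree:
`map_mem_algebraicClasses_of_flat`). [cite: Fulton1998, Cor. 19.2 (b)] [informal size L; known] -/
theorem stub_algebraicClassesFunctorial : lefschetzOneOne_rational →
    (∀ ⦃𝒳 S : Motives.SchemeOver ℂ⦄ (f : 𝒳 ⟶ S) (n p : ℕ), AVFamily[𝒳, S, f, n] →
      ∀ (r : ℕ) (G : Fin r → complexBetti 𝒳 (2 * p)),
        (∀ j s, Res[f, s, 2 * p, G j] ∈ algebraicClasses (Motives.fiberOver f s) p) →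
        ∀ W ∈ Submodule.span ℂ
            ({x : complexBetti 𝒳 (2 * p) | ∃ (j : Fin r) (u : 𝒳 ⟶ 𝒳), u ≫ f = f ∧
                x = complexBetti.map u (2 * p) (G j)} ∪ DivPow[𝒳, f, n, p]),
          ∀ s, Res[f, s, 2 * p, W] ∈ algebraicClasses (Motives.fiberOver f s) p) ∧
    (∀ (A B : AbelianVariety ℂ) (φ : A ⟶ B) (p : ℕ) (w : complexBetti B.X (2 * p)),
      w ∈ algebraicClasses B.X p → complexBetti.map φ.hom.hom.hom (2 * p) w ∈ algebraicClasses A.X p) ∧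
    (∀ (B : AbelianVariety ℂ) (Y : Motives.SchemeOver ℂ) (e : B.X ≅ Y) (p : ℕ) (y : complexBetti Y (2 * p)),
      y ∈ algebraicClasses Y p → complexBetti.map e.hom (2 * p) y ∈ algebraicClasses B.X p) := by
  sorry

/-- **Stub 6 · `stub_hodgeFacts` — the three named Literature facts consumed by the deep-middle
reduction (theorems in print, vendored as facts):** existence of Hodge models for smooth projective
varieties (Serre GAGA + de Rham + Hodge decomposition: `nonempty_hodgeModel`), Lefschetz `(1,1)`
(`lefschetzOneOne_rational`, Voisin I Thm 11.30) and hard Lefschetz in the `n`-fold package form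
(`nonempty_hardLefschetzNFold`, Voisin I Thm 6.25).  [cite: VoisinHodgeI2002, Thm. 6.25 and Thm. 11.30]
[informal size: Literature-side XL; known] -/
theorem stub_hodgeFacts : (∀ (n : ℕ) (X : Motives.SchemeOver ℂ), nonempty_hodgeModel n X) ∧
    lefschetzOneOne_rational ∧ (∀ (n : ℕ) (X : Motives.SchemeOver ℂ), nonempty_hardLefschetzNFold n X) := by
  sorry

/-! ## The composition (kernel-checked; no `sorry` below this line) -/

/-- **Every seed-certified class is algebraic** (from Stubs 3, 4, 5(a), 5(c)): each seed class `G_j`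
is algebraic near `z_j` (semiregular VHC), hence on every fibre (spreading); then `W` is algebraic on
every fibre (endomorphism-translates + divisor powers), in particular on `𝒳_{s₁} ≅ B`. -/
theorem mem_algebraicClasses_of_certified
    (h₃ : Goal.stub_semiregularVHC) (h₄ : Goal.stub_baireSpreading)
    (h₅ : Goal.stub_algebraicClassesFunctorial) (h11 : lefschetzOneOne_rational)
    (T : ChernCharacterBetti) (B : AbelianVariety ℂ) (p : ℕ) (w : complexBetti B.X (2 * p))
    (hw : Certified[T, B, p, w]) : w ∈ algebraicClasses B.X p := by
  obtain ⟨h5a, -, h5c⟩ := h₅ h11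
  obtain ⟨𝒳, S, f, s₁, e, W, hfam, -, hWw, r, z, G, hseed, hspan⟩ := hw
  have hG : ∀ (j : Fin r) (s : Motives.ComplexPoints S),
      Res[f, s, 2 * p, G j] ∈ algebraicClasses (Motives.fiberOver f s) p := by
    intro j
    obtain ⟨U, hUo, hzU, hU⟩ := h₃ T f B.dim p (G j) (z j) hfam (hseed j)
    exact h₄ f B.dim p (G j) hfam ⟨U, hUo, ⟨z j, hzU⟩, hU⟩
  rw [← hWw]
  exact h5c B _ e p _ (h5a f B.dim p hfam r G hG W hspan s₁)

/-- **`HodgeAbelianVarieties_of` — the line's composition, concluding the crux BY NAME.**  Deep-middle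
reduction (landed Negative lemma `hodgeAbelianVarieties_iff_deepMiddle` fed by Stub 6) → generation
(Stub 2 fed by Stub 1) → every generator `φ^* w` is algebraic (`mem_algebraicClasses_of_certified` and
Stub 5(b)) → span. -/
theorem HodgeAbelianVarieties_of
    (h₁ : Goal.stub_weilSectorSeeds) (h₂ : Goal.stub_seededGeneration)
    (h₃ : Goal.stub_semiregularVHC) (h₄ : Goal.stub_baireSpreading)
    (h₅ : Goal.stub_algebraicClassesFunctorial) (h₆ : Goal.stub_hodgeFacts) :
    HodgeAbelianVarieties := by
  obtain ⟨hM, h11, hHL⟩ := h₆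
  refine (Summit.HodgeConjecture.HodgeConjecture.Theorems.HodgeAbelianVarieties.Negative.hodgeAbelianVarieties_iff_deepMiddle
    hM h11 hHL).2 ?_
  intro A p hp2 hpd c hc hpp
  obtain ⟨T, hT⟩ := h₁
  have hgen := h₂ T hT A p hp2 hpd c hc hpp
  refine (Submodule.span_le.mpr ?_) hgen
  rintro x ⟨B, φ, w, hcert, rfl⟩
  obtain ⟨-, h5b, -⟩ := h₅ h11
  exact h5b A B φ p w (mem_algebraicClasses_of_certified h₃ h₄ h₅ h11 T B p w hcert)

/-- The crux from the stubs as they stand (depends on their `sorry`s; shows the composition closes). -/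
theorem HodgeAbelianVarieties_of_stubs : HodgeAbelianVarieties :=
  HodgeAbelianVarieties_of stub_weilSectorSeeds stub_seededGeneration stub_semiregularVHC
    stub_baireSpreading stub_algebraicClassesFunctorial stub_hodgeFacts

end Summit.HodgeConjecture.HodgeConjecture.Cruxes.HodgeAbelianVarieties.SymmetryLadderIsotypicObstructions

end
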